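import Literature.Algebra.Homology.RightDerivedFunctorPlusInjectiveModel
import Mathlib.CategoryTheory.Abelian.GrothendieckAxioms.Basic
import HarnessLib

/-!
# Functoriality of the right derived functor on `D⁺`: invariance under isomorphism of functors,
# post-composition with an EXACT functor, pre-composition with an exact functor PRESERVING INJECTIVES
# (Weibel 10.5.6, 10.8.2–10.8.3 (Grothendieck composition, degenerate cases); Hartshorne III Prop. 8.1 shape)

Layer `Literature/Algebra/Homology` (pure homological algebra; no schemes). Continuation of
`RightDerivedFunctorPlusInjectiveModel` (the injective model `K⁺(Inj C) ≌ D⁺(C)` and `RF ≅ q ∘ F ∘ U`). Everything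
here is read on the injective model and then descended along the equivalence (`isoOfPrecompEquivalence`: an
isomorphism of functors out of `D⁺(C)` is determined by its restriction to `K⁺(Inj C)`). Everything PROVED, 0 named
facts, no instances.

* §0 bookkeeping: `isoOfPrecompEquivalence`, `natIsoMapHomotopyCategory` ∕ `natIsoMapHomotopyCategoryPlus`
  (`F ≅ F'` ⟹ `K⁺(F) ≅ K⁺(F')`), `injective_mapHomotopyCategoryPlus_obj_X` (terms of `K⁺(ι ⋙ G)(X)` are `G` of injectives).
* §1 **`Functor.rightDerivedFunctorPlusIsoOfIso (e : F ≅ F') : RF ≅ RF'`**; for exact functors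
  `Functor.mapDerivedCategoryIsoOfIso` ∕ `Functor.mapDerivedCategoryPlusIsoOfIso` (`G ≅ G'` ⟹ `D(G) ≅ D(G')`, `D⁺(G) ≅ D⁺(G')`)
  and `Functor.mapDerivedCategoryCompIso` ∕ `Functor.mapDerivedCategoryPlusCompIso` (`D(G ⋙ G') ≅ D(G) ⋙ D(G')`, same on `D⁺`).
* §2 **`Functor.rightDerivedFunctorPlusCompExactIso : RF ⋙ D⁺(H) ≅ R(F ⋙ H)`** for `H` EXACT (`D⁺(H) = H.mapDerivedCategoryPlus`)
  — the degenerate Grothendieck composition "`R(H ∘ F) = H ∘ RF` when `H` is exact".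
* §3 **`Functor.rightDerivedFunctorPlusExactCompIso : D⁺(G) ⋙ RF ≅ R(G ⋙ F)`** for `G : C' ⥤ C` EXACT and carrying
  injectives to injectives (e.g. an equivalence, or a functor with an exact left adjoint) — "`R(F ∘ G) = RF ∘ G` when
  `G` is exact and preserves injectives" (Weibel 10.8.2 hypotheses, degenerate case of 10.8.3).

Typed for the cell `pub-hodge-ring2` (plate P3 of the (M1) library debt of crux 26512: base change of `Rf_*` along
automorphisms and the derived projection formula read through these three lemmas); a research route conditional
on HC_CM, not a corollary — nothing in this file refers to it.

## References

* C. A. Weibel, *An introduction to homological algebra* (1994), Existence Thm. 10.5.6 (`RF = qFU`), 10.8.2–10.8.3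
  (Grothendieck spectral sequence ∕ composition of derived functors: `G` sends injectives to `F`-acyclics). [Weibel1994]
* R. Hartshorne, *Algebraic Geometry* (1977), III §1 Thm. 1.1A, III Prop. 8.1 (derived functors computed after an
  exact functor). [Hartshorne1977]
-/

noncomputable section

open CategoryTheory CategoryTheory.Limits

universe w w' w'' v v' v'' u u' u''

namespace CategoryTheory

/-! ### §0 Bookkeeping -/

section Bookkeeping

variable {X : Type u} [Category.{v} X] {Y : Type u'} [Category.{v'} Y] {Z : Type u''} [Category.{v''} Z]

/-- An isomorphism of functors out of `Y` is determined by its restriction along an equivalence `X ≌ Y`: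
from `e.functor ⋙ A ≅ e.functor ⋙ B` to `A ≅ B`. [cite: Weibel1994, Thm. 10.4.8 (use of the equivalence K⁺(I) ≅ D⁺)] -/
def isoOfPrecompEquivalence (e : X ≌ Y) {A B : Y ⥤ Z} (i : e.functor ⋙ A ≅ e.functor ⋙ B) : A ≅ B :=
  (e.invFunIdAssoc A).symm ≪≫ Functor.isoWhiskerLeft e.inverse i ≪≫ e.invFunIdAssoc B

variable {V : Type u} [Category.{v} V] [Preadditive V] {W : Type u'} [Category.{v'} W] [Preadditive W]

/-- An isomorphism of additive functors induces an isomorphism of the induced functors on homotopy categories.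
[cite: Weibel1994, 10.1 (K is functorial in additive functors)] -/
def natIsoMapHomotopyCategory {F G : V ⥤ W} [F.Additive] [G.Additive] (e : F ≅ G) (c : ComplexShape ℤ) :
    F.mapHomotopyCategory c ≅ G.mapHomotopyCategory c where
  hom := NatTrans.mapHomotopyCategory e.hom c
  inv := NatTrans.mapHomotopyCategory e.inv c
  hom_inv_id := by rw [← NatTrans.mapHomotopyCategory_comp, e.hom_inv_id, NatTrans.mapHomotopyCategory_id]
  inv_hom_id := by rw [← NatTrans.mapHomotopyCategory_comp, e.inv_hom_id, NatTrans.mapHomotopyCategory_id]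

variable [HasZeroObject V] [HasBinaryBiproducts V] [HasZeroObject W] [HasBinaryBiproducts W] in
/-- An isomorphism of additive functors induces an isomorphism of the induced functors on the bounded-below
homotopy categories `K⁺`. [cite: Weibel1994, 10.1] -/
def natIsoMapHomotopyCategoryPlus {F G : V ⥤ W} [F.Additive] [G.Additive] (e : F ≅ G) :
    F.mapHomotopyCategoryPlus ≅ G.mapHomotopyCategoryPlus :=
  ((HomotopyCategory.plus W).fullyFaithfulι.whiskeringRight (HomotopyCategory.Plus V)).preimageIso
    (Functor.isoWhiskerLeft (HomotopyCategory.Plus.ι V) (natIsoMapHomotopyCategory e (ComplexShape.up ℤ)))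

end Bookkeeping

variable {C : Type u} [Category.{v} C] [Abelian C] [HasDerivedCategory.{w} C]
  {C' : Type u'} [Category.{v'} C'] [Abelian C'] [HasDerivedCategory.{w'} C']
  {D : Type u''} [Category.{v''} D] [Abelian D] [HasDerivedCategory.{w''} D]

omit [HasDerivedCategory C] [HasDerivedCategory C'] in
/-- The terms of `K⁺(ι' ⋙ G)(X)`, `X ∈ K⁺(Inj C')`, are injective when `G` carries injectives to injectives.
[cite: Weibel1994, 10.8.2 (hypothesis: G sends injectives to F-acyclics; here to injectives)] -/
theorem injective_mapHomotopyCategoryPlus_obj_X (G : C' ⥤ C) [G.Additive]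
    (hG : ∀ I : C', Injective I → Injective (G.obj I)) (X : HomotopyCategory.Plus (InjectiveObject C')) (n : ℤ) :
    Injective (((InjectiveObject.ι C' ⋙ G).mapHomotopyCategoryPlus.obj X).obj.as.X n) :=
  hG _ (X.obj.as.X n).property

namespace Functor

open InjectiveObject

/-! ### §1 Invariance under isomorphism of functors -/

section OfIso

variable (F F' : C ⥤ D) [F.Additive] [F'.Additive] [EnoughInjectives C]

/-- **`RF ≅ RF'` for isomorphic additive functors `F ≅ F'`** (both are `U ⋙ K⁺(ι ⋙ –) ⋙ q` on the injective model).
[cite: Weibel1994, Existence Thm. 10.5.6] -/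
def rightDerivedFunctorPlusIsoOfIso (e : F ≅ F') : F.rightDerivedFunctorPlus ≅ F'.rightDerivedFunctorPlus :=
  isoOfPrecompEquivalence (derivedPlusModelEquivalence C)
    (F.rightDerivedFunctorPlusModelIso ≪≫
      isoWhiskerRight (natIsoMapHomotopyCategoryPlus (isoWhiskerLeft (InjectiveObject.ι C) e)) _ ≪≫
      F'.rightDerivedFunctorPlusModelIso.symm)

end OfIso

section ExactOfIso

variable (G G' : C ⥤ D) [G.Additive] [PreservesFiniteLimits G] [PreservesFiniteColimits G]
  [G'.Additive] [PreservesFiniteLimits G'] [PreservesFiniteColimits G']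

omit [HasDerivedCategory C'] in
/-- **`D(G) ≅ D(G')` for isomorphic exact functors** (uniqueness of the localised functor: both lift
`C(G) ⋙ Q ≅ C(G') ⋙ Q`). [cite: Weibel1994, Exact Functors 10.5.2] -/
def mapDerivedCategoryIsoOfIso (e : G ≅ G') : G.mapDerivedCategory ≅ G'.mapDerivedCategory :=
  Localization.liftNatIso DerivedCategory.Q (HomologicalComplex.quasiIso C (ComplexShape.up ℤ))
    (G.mapHomologicalComplex _ ⋙ DerivedCategory.Q) (G'.mapHomologicalComplex _ ⋙ DerivedCategory.Q) _ _
    (isoWhiskerRight (NatIso.mapHomologicalComplex e (ComplexShape.up ℤ)) DerivedCategory.Q)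

omit [HasDerivedCategory C'] in
/-- **`D⁺(G) ≅ D⁺(G')` for isomorphic exact functors** (restriction of `mapDerivedCategoryIsoOfIso` to `D⁺`,
`Plus.ι` being fully faithful). [cite: Weibel1994, Exact Functors 10.5.2] -/
def mapDerivedCategoryPlusIsoOfIso (e : G ≅ G') : G.mapDerivedCategoryPlus ≅ G'.mapDerivedCategoryPlus :=
  ((DerivedCategory.TStructure.t (C := D)).plus.fullyFaithfulι.whiskeringRight (DerivedCategory.Plus C)).preimageIso
    (isoWhiskerLeft DerivedCategory.Plus.ι (mapDerivedCategoryIsoOfIso G G' e))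

end ExactOfIso

section ExactComp₂

variable (G : C ⥤ C') [G.Additive] [PreservesFiniteLimits G] [PreservesFiniteColimits G]
  (G' : C' ⥤ D) [G'.Additive] [PreservesFiniteLimits G'] [PreservesFiniteColimits G']

/-- The lifting datum for the composite of two exact functors: `Q ⋙ (D(G) ⋙ D(G')) ≅ C(G ⋙ G') ⋙ Q`.
[cite: Weibel1994, Exact Functors 10.5.2] -/
@[implicit_reducible]
def mapDerivedCategoryCompLifting :
    Localization.Lifting DerivedCategory.Q (HomologicalComplex.quasiIso C (ComplexShape.up ℤ))
      ((G ⋙ G').mapHomologicalComplex (ComplexShape.up ℤ) ⋙ DerivedCategory.Q)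
      (G.mapDerivedCategory ⋙ G'.mapDerivedCategory) :=
  ⟨(Functor.associator _ _ _).symm ≪≫ isoWhiskerRight G.mapDerivedCategoryFactors G'.mapDerivedCategory ≪≫
      Functor.associator _ _ _ ≪≫ isoWhiskerLeft (G.mapHomologicalComplex _) G'.mapDerivedCategoryFactors ≪≫
      (Functor.associator _ _ _).symm ≪≫
      isoWhiskerRight (Iso.refl _ : G.mapHomologicalComplex (ComplexShape.up ℤ) ⋙ G'.mapHomologicalComplex _ ≅
        (G ⋙ G').mapHomologicalComplex (ComplexShape.up ℤ)) DerivedCategory.Q⟩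

/-- **`D(G ⋙ G') ≅ D(G) ⋙ D(G')` for exact functors** (uniqueness of the localised functor).
[cite: Weibel1994, Exact Functors 10.5.2] -/
def mapDerivedCategoryCompIso : (G ⋙ G').mapDerivedCategory ≅ G.mapDerivedCategory ⋙ G'.mapDerivedCategory :=
  letI := mapDerivedCategoryCompLifting G G'
  Localization.liftNatIso DerivedCategory.Q (HomologicalComplex.quasiIso C (ComplexShape.up ℤ))
    ((G ⋙ G').mapHomologicalComplex (ComplexShape.up ℤ) ⋙ DerivedCategory.Q)
    ((G ⋙ G').mapHomologicalComplex (ComplexShape.up ℤ) ⋙ DerivedCategory.Q) _ _ (Iso.refl _)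

/-- **`D⁺(G ⋙ G') ≅ D⁺(G) ⋙ D⁺(G')` for exact functors** (restriction to `D⁺`, `Plus.ι` fully faithful).
[cite: Weibel1994, Exact Functors 10.5.2] -/
def mapDerivedCategoryPlusCompIso :
    (G ⋙ G').mapDerivedCategoryPlus ≅ G.mapDerivedCategoryPlus ⋙ G'.mapDerivedCategoryPlus :=
  ((DerivedCategory.TStructure.t (C := D)).plus.fullyFaithfulι.whiskeringRight (DerivedCategory.Plus C)).preimageIso
    (isoWhiskerLeft DerivedCategory.Plus.ι (mapDerivedCategoryCompIso G G'))

end ExactComp₂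

/-! ### §2 Post-composition with an exact functor -/

section CompExact

variable (F : C ⥤ D) [F.Additive] [EnoughInjectives C]
  (H : D ⥤ C') [H.Additive] [PreservesFiniteLimits H] [PreservesFiniteColimits H]

/-- **`RF ⋙ D⁺(H) ≅ R(F ⋙ H)` for `H` exact**: an exact functor needs no deriving, so it can be applied after `RF`
("`R(H ∘ F) ≅ H ∘ RF`"). On the injective model both sides are `K⁺(ι ⋙ F ⋙ H) ⋙ q`.
[cite: Weibel1994, 10.8.2–10.8.3 (degenerate case: the second functor exact)] [cite: Hartshorne1977, III Prop. 8.1 (shape)] -/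
def rightDerivedFunctorPlusCompExactIso :
    F.rightDerivedFunctorPlus ⋙ H.mapDerivedCategoryPlus ≅ (F ⋙ H).rightDerivedFunctorPlus :=
  isoOfPrecompEquivalence (derivedPlusModelEquivalence C)
    ((Functor.associator _ _ _).symm ≪≫
      isoWhiskerRight F.rightDerivedFunctorPlusModelIso H.mapDerivedCategoryPlus ≪≫
      Functor.associator _ _ _ ≪≫
      isoWhiskerLeft (InjectiveObject.ι C ⋙ F).mapHomotopyCategoryPlus H.mapDerivedCategoryPlusFactorsh ≪≫
      (Functor.associator _ _ _).symm ≪≫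
      isoWhiskerRight (Functor.mapHomotopyCategoryPlusCompIso (Iso.refl ((InjectiveObject.ι C ⋙ F) ⋙ H))) _ ≪≫
      isoWhiskerRight (natIsoMapHomotopyCategoryPlus (Functor.associator (InjectiveObject.ι C) F H)) _ ≪≫
      (F ⋙ H).rightDerivedFunctorPlusModelIso.symm)

end CompExact

/-! ### §3 Pre-composition with an exact functor preserving injectives -/

section ExactComp

variable (G : C' ⥤ C) [G.Additive] [PreservesFiniteLimits G] [PreservesFiniteColimits G]
  (hG : ∀ I : C', Injective I → Injective (G.obj I))
  (F : C ⥤ D) [F.Additive] [EnoughInjectives C] [EnoughInjectives C']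

/-- On the injective model of `C'`: `K⁺(ι') ⋙ K⁺(G) ⋙ q ⋙ RF ≅ K⁺(ι') ⋙ K⁺(G) ⋙ K⁺(F) ⋙ q` — the unit of `RF` is an
isomorphism on `K⁺(G)` of a complex of injectives, because `G` preserves injectives.
[cite: Weibel1994, Existence Thm. 10.5.6 (R⁺F(I) ≅ qF(I)) with 10.8.2] -/
def rightDerivedFunctorPlusUnitIsoOfPreservesInjectives :
    (InjectiveObject.ι C' ⋙ G).mapHomotopyCategoryPlus ⋙ F.mapHomotopyCategoryPlus ⋙ DerivedCategory.Plus.Qh ≅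
      (InjectiveObject.ι C' ⋙ G).mapHomotopyCategoryPlus ⋙ DerivedCategory.Plus.Qh ⋙ F.rightDerivedFunctorPlus :=
  haveI : ∀ X, IsIso ((whiskerLeft (InjectiveObject.ι C' ⋙ G).mapHomotopyCategoryPlus F.rightDerivedFunctorPlusUnit).app X) :=
    fun X => by
      haveI := injective_mapHomotopyCategoryPlus_obj_X G hG X
      exact F.isIso_rightDerivedFunctorPlusUnit_app (((InjectiveObject.ι C' ⋙ G).mapHomotopyCategoryPlus).obj X)
  haveI : IsIso (whiskerLeft (InjectiveObject.ι C' ⋙ G).mapHomotopyCategoryPlus F.rightDerivedFunctorPlusUnit) :=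
    NatIso.isIso_of_isIso_app _
  asIso (whiskerLeft (InjectiveObject.ι C' ⋙ G).mapHomotopyCategoryPlus F.rightDerivedFunctorPlusUnit)

/-- **`D⁺(G) ⋙ RF ≅ R(G ⋙ F)` for `G` exact carrying injectives to injectives**: `RF` may be computed after `G`
("`R(F ∘ G) ≅ RF ∘ G`"), since `G` of an injective resolution is an injective resolution. On the injective model of
`C'` both sides are `K⁺(ι' ⋙ G ⋙ F) ⋙ q`. [cite: Weibel1994, 10.8.2–10.8.3 (degenerate case: the first functor exact and preserving injectives)]
[cite: Hartshorne1977, III Prop. 8.1 (shape)] -/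
def rightDerivedFunctorPlusExactCompIso :
    G.mapDerivedCategoryPlus ⋙ F.rightDerivedFunctorPlus ≅ (G ⋙ F).rightDerivedFunctorPlus :=
  isoOfPrecompEquivalence (derivedPlusModelEquivalence C')
    (-- `(K⁺(ι') ⋙ q') ⋙ D⁺(G) ⋙ RF ≅ K⁺(ι') ⋙ (K⁺(G) ⋙ q) ⋙ RF`
      (Functor.associator (InjectiveObject.ι C').mapHomotopyCategoryPlus DerivedCategory.Plus.Qh
          (G.mapDerivedCategoryPlus ⋙ F.rightDerivedFunctorPlus) :
        derivedPlusModel C' ⋙ G.mapDerivedCategoryPlus ⋙ F.rightDerivedFunctorPlus ≅ _) ≪≫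
      isoWhiskerLeft (InjectiveObject.ι C').mapHomotopyCategoryPlus
        ((Functor.associator _ _ _).symm ≪≫ isoWhiskerRight G.mapDerivedCategoryPlusFactorsh F.rightDerivedFunctorPlus ≪≫
          Functor.associator _ _ _) ≪≫
      (Functor.associator _ _ _).symm ≪≫
      isoWhiskerRight (Functor.mapHomotopyCategoryPlusCompIso (Iso.refl (InjectiveObject.ι C' ⋙ G))) _ ≪≫
      -- the unit of `RF` is an iso on `K⁺(ι' ⋙ G)`
      (rightDerivedFunctorPlusUnitIsoOfPreservesInjectives G hG F).symm ≪≫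
      -- `K⁺(ι' ⋙ G) ⋙ K⁺(F) ⋙ q ≅ K⁺(ι' ⋙ (G ⋙ F)) ⋙ q ≅ model ⋙ R(G ⋙ F)`
      (Functor.associator _ _ _).symm ≪≫
      isoWhiskerRight (Functor.mapHomotopyCategoryPlusCompIso (Iso.refl ((InjectiveObject.ι C' ⋙ G) ⋙ F))) _ ≪≫
      isoWhiskerRight (natIsoMapHomotopyCategoryPlus (Functor.associator (InjectiveObject.ι C') G F)) _ ≪≫
      (G ⋙ F).rightDerivedFunctorPlusModelIso.symm)

end ExactComp

end Functor

end CategoryTheory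

end
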